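import Literature.InformationTheory.QuantumCodes.LiftedProductSwap
import Literature.InformationTheory.QuantumCodes.CSSEquivalence
import Mathlib.LinearAlgebra.Matrix.Circulant
import HarnessLib

/-!
# Typed quasi-cyclic lifted-product codes `LP(A, [b])` for the census (objects + index layout), qec-search-4

The census rows of family LP (cell D.1-lite: `Census/LP/<Name>/`) enter the tree as explicit check-matrix words
(`<Name>.cert.code _`). This module supplies the TYPED object they are transported to — Panteleev–Kalachev's lifted
product `LP(A, B)` of `Literature/InformationTheory/QuantumCodes/LiftedProduct.lean` (qec-type-07) instantiated over the
commutative ring `𝔽₂[x]/(x^ℓ − 1)` realised as `ℓ × ℓ` circulants (Mathlib `Matrix.circulant`, `𝔅(a)_{st} = a_{s−t}`):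

* `monoBlocks ℓ E` — the monomial matrix `A = (x^{E i j})` as circulant blocks; `polyBlock ℓ es` — the `1 × 1` matrix `[b]`,
  `b = Σ_{e ∈ es} x^e`;
* `elementwiseCommute_circulant` / `elementwiseCommute_mono_poly` — circulant blocks commute element-wise (Mathlib
  `Matrix.Fin.circulant_mul_comm`), the hypothesis of `LiftedProduct.xMatrix_mul_zMatrix_transpose` (PROVED there);
* `lpCode ℓ E es : CSSCode …` — the CSS code `(𝔅H_X(A,[b]), 𝔅H_Z(A,[b]))` (type-02 `CSSCode.ofMatrices`);
* `rowEquiv m ℓ : Fin (m·ℓ) ≃ (Fin m × Fin 1) × Fin ℓ` (`r = ℓ·i + a ↦ ((i,0),a)`) and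
  `colEquiv n m ℓ : Fin ((n+m)·ℓ) ≃ ((Fin n × Fin 1) ⊕ (Fin m × Fin 1)) × Fin ℓ` (`q = ℓ·c + t`; blocks `c < n` are the
  `A ⊗ I` columns, `c ≥ n` the `I ⊗ [b]` columns) — the layout of census/search-4's generator `s4lib.lp()`.
Per row (`Census/LP/<Name>/Typed.lean`): `HX_eq`/`HZ_eq` — the census matrices ARE `𝔅H_X`, `𝔅H_Z` of the typed code along
these bijections (`decide +kernel` over the product-free entry formulas `LiftedProduct.xMatrix_eq_of_xEntry` /
`zMatrix_eq_of_zEntry`) — and `isCode_lp : (lpCode ℓ E es).IsCode n k d` by type-05's FACT P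
(`CSSCode.isCode_iff_of_submatrix`) from the row's KERNEL theorem `isCode`. Tier KERNEL, axioms standard, no `native_decide`.
-/

set_option autoImplicit false

namespace Summit.Ventures.QEC.Census.LPTyped

open Matrix Literature.InformationTheory.QuantumCodes LiftedProduct

/-- Monomial base matrix lifted to circulant blocks: `A i j = 𝔅(x^{E i j})` with `𝔅(a)_{st} = a_{s−t}` over
`𝔽₂[x]/(x^ℓ − 1)` (Panteleev–Kalachev's `𝔅`, census s4lib `circulant()`). (definition, computable)
[cite: PanteleevKalachev2022LP, §III.E (arXiv:2012.04068 chunk p0012 L9-10): quasi-cyclic LP codes over `R_ℓ`] -/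
def monoBlocks {m n : ℕ} (ℓ : ℕ) (E : Fin m → Fin n → ℕ) : Matrix (Fin m) (Fin n) (Matrix (Fin ℓ) (Fin ℓ) (ZMod 2)) :=
  fun i j => Matrix.circulant fun t => if (t : ℕ) = E i j % ℓ then 1 else 0

/-- The `1 × 1` matrix `[b]`, `b = Σ_{e ∈ es} x^e` (exponents distinct mod `ℓ`), as a circulant block. (definition, computable)
[cite: PanteleevKalachev2022LP, §III.E (arXiv:2012.04068 chunk p0012 L9-10)] -/
def polyBlock (ℓ : ℕ) (es : List ℕ) : Matrix (Fin 1) (Fin 1) (Matrix (Fin ℓ) (Fin ℓ) (ZMod 2)) :=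
  fun _ _ => Matrix.circulant fun t => if (t : ℕ) ∈ es.map (· % ℓ) then 1 else 0

/-- Circulant blocks commute element-wise (Mathlib `Matrix.Fin.circulant_mul_comm`): the operative hypothesis
`LiftedProduct.ElementwiseCommute` of the lifted product over the commutative ring `𝔽₂[x]/(x^ℓ − 1)`.
[cite: PanteleevKalachev2022LP, §III.E (arXiv:2012.04068 chunk p0012 L9: "enforce R to be a commutative ring")] -/
theorem elementwiseCommute_circulant {m n m' n' ℓ : ℕ} (v : Fin m → Fin n → Fin ℓ → ZMod 2)
    (w : Fin m' → Fin n' → Fin ℓ → ZMod 2) :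
    ElementwiseCommute (fun i j => Matrix.circulant (v i j)) (fun s t => Matrix.circulant (w s t)) :=
  fun i j s t => Matrix.Fin.circulant_mul_comm (v i j) (w s t)

/-- `monoBlocks ℓ E` and `polyBlock ℓ es` commute element-wise. [cite: PanteleevKalachev2022LP, §III.E (arXiv:2012.04068 chunk p0012 L9)] -/
theorem elementwiseCommute_mono_poly {m n : ℕ} (ℓ : ℕ) (E : Fin m → Fin n → ℕ) (es : List ℕ) :
    ElementwiseCommute (monoBlocks ℓ E) (polyBlock ℓ es) :=
  elementwiseCommute_circulant _ _

/-- **The typed quasi-cyclic lifted-product code `LP(A, [b])`** (`A = (x^{E i j})` an `m × n` monomial matrix,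
`b = Σ_{e ∈ es} x^e`, over `𝔽₂[x]/(x^ℓ − 1)`) as a CSS code: checks `𝔅H_X(A,[b])` (`(m × 1) × ℓ` rows), `𝔅H_Z(A,[b])`
(`(n × 1) × ℓ` rows), qubits `((n × 1) ⊕ (m × 1)) × ℓ` — `N = ℓ(n + m)`; CSS condition by
`LiftedProduct.xMatrix_mul_zMatrix_transpose`. (definition)
[cite: PanteleevKalachev2022LP, §III.D (arXiv:2012.04068 chunk p0011 L5-12, L45): `LP(A,B)`, `N = ℓ(n_A m_B + n_B m_A)`] -/
abbrev lpCode {m n : ℕ} (ℓ : ℕ) (E : Fin m → Fin n → ℕ) (es : List ℕ) :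
    CSSCode ((Fin m × Fin 1) × Fin ℓ) ((Fin n × Fin 1) × Fin ℓ) (((Fin n × Fin 1) ⊕ (Fin m × Fin 1)) × Fin ℓ) :=
  CSSCode.ofMatrices (xMatrix (monoBlocks ℓ E) (polyBlock ℓ es)) (zMatrix (monoBlocks ℓ E) (polyBlock ℓ es))
    (xMatrix_mul_zMatrix_transpose (elementwiseCommute_mono_poly ℓ E es))

/-- Check-row layout of the census objects: `r = ℓ·i + a ↦ ((i, 0), a)` (s4lib's `ring_kron_identity_*` + `ring_to_binary`).
(definition) [folklore] -/
def rowEquiv (m ℓ : ℕ) : Fin (m * ℓ) ≃ (Fin m × Fin 1) × Fin ℓ :=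
  (finProdFinEquiv (m := m) (n := ℓ)).symm.trans ((Equiv.prodUnique (Fin m) (Fin 1)).symm.prodCongr (Equiv.refl (Fin ℓ)))

/-- Qubit layout of the census objects: `q = ℓ·c + t`; column blocks `c < n` ↦ `(inl (c, 0), t)` (the `A ⊗ I` columns),
`c = n + c'` ↦ `(inr (c', 0), t)` (the `I ⊗ [b]` columns) — s4lib `lp()` = `ring_hcat`. (definition) [folklore] -/
def colEquiv (n m ℓ : ℕ) : Fin ((n + m) * ℓ) ≃ ((Fin n × Fin 1) ⊕ (Fin m × Fin 1)) × Fin ℓ :=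
  (finProdFinEquiv (m := n + m) (n := ℓ)).symm.trans
    (((finSumFinEquiv (m := n) (n := m)).symm.trans
      ((Equiv.prodUnique (Fin n) (Fin 1)).symm.sumCongr (Equiv.prodUnique (Fin m) (Fin 1)).symm)).prodCongr (Equiv.refl (Fin ℓ)))

/-! ## `LP(A, A*)` (Panteleev–Kalachev §III.D Example 3) — appended 2026-08-27 (qec-search-4 g3) -/

/-- `A` and `A*` commute element-wise (circulant blocks; `(𝔅(x^e))ᵀ = 𝔅(x^{−e})` by Mathlib `transpose_circulant`).
[cite: PanteleevKalachev2022LP, §III.D Example 3 (arXiv:2012.04068 chunk p0011 L60-61: "A … over a commutative ring R ⊆ Mat_ℓ(𝔽₂) and B = A*")] -/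
theorem elementwiseCommute_mono_star {m n : ℕ} (ℓ : ℕ) [NeZero ℓ] (E : Fin m → Fin n → ℕ) :
    ElementwiseCommute (monoBlocks ℓ E) (blockStar (monoBlocks ℓ E)) := by
  intro i j s t
  simp only [monoBlocks, blockStar_apply, Matrix.transpose_circulant]
  exact Matrix.Fin.circulant_mul_comm _ _

/-- **The typed `LP(A, A*)` code** (`A = (x^{E i j})` an `m × n` monomial matrix over `𝔽₂[x]/(x^ℓ − 1)`): checks
`𝔅H_X(A,A*)` (`(m × n) × ℓ` rows), `𝔅H_Z(A,A*)` (`(n × m) × ℓ` rows), qubits `((n × n) ⊕ (m × m)) × ℓ` — `N = ℓ(n² + m²)`;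
by `LiftedProduct.dX_eq_dZ_of_lp_self` every such code has `d_X = d_Z`. (definition)
[cite: PanteleevKalachev2022LP, §III.D Example 3 (arXiv:2012.04068 chunk p0011 L60-64: "LP(A) = LP(A, A*) of length N = ℓ(n² + m²)")] -/
abbrev lpCodeSelf {m n : ℕ} (ℓ : ℕ) [NeZero ℓ] (E : Fin m → Fin n → ℕ) :
    CSSCode ((Fin m × Fin n) × Fin ℓ) ((Fin n × Fin m) × Fin ℓ) (((Fin n × Fin n) ⊕ (Fin m × Fin m)) × Fin ℓ) :=
  CSSCode.ofMatrices (xMatrix (monoBlocks ℓ E) (blockStar (monoBlocks ℓ E)))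
    (zMatrix (monoBlocks ℓ E) (blockStar (monoBlocks ℓ E))) (xMatrix_mul_zMatrix_transpose (elementwiseCommute_mono_star ℓ E))

/-- Check-row layout of the `LP(A, A*)` census objects: `r = ℓ·(n·i + s) + a ↦ ((i, s), a)` (s4lib `lp(A, A*)`). (definition) [folklore] -/
def rowEquiv2 (m n ℓ : ℕ) : Fin ((m * n) * ℓ) ≃ (Fin m × Fin n) × Fin ℓ :=
  (finProdFinEquiv (m := m * n) (n := ℓ)).symm.trans ((finProdFinEquiv (m := m) (n := n)).symm.prodCongr (Equiv.refl (Fin ℓ)))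

/-- Qubit layout of the `LP(A, A*)` census objects: `q = ℓ·c + t`; blocks `c = n·j + s < n²` ↦ `(inl (j, s), t)` (the `A ⊗ I`
columns), `c = n² + m·s' + j'` ↦ `(inr (s', j'), t)` (the `I ⊗ A*` columns). (definition) [folklore] -/
def colEquiv2 (n m ℓ : ℕ) : Fin ((n * n + m * m) * ℓ) ≃ ((Fin n × Fin n) ⊕ (Fin m × Fin m)) × Fin ℓ :=
  (finProdFinEquiv (m := n * n + m * m) (n := ℓ)).symm.trans
    (((finSumFinEquiv (m := n * n) (n := m * m)).symm.trans
      ((finProdFinEquiv (m := n) (n := n)).symm.sumCongr (finProdFinEquiv (m := m) (n := m)).symm)).prodCongr (Equiv.refl (Fin ℓ)))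

end Summit.Ventures.QEC.Census.LPTyped
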